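/-
Origin: expansion seat `planner-pub-hodgecm-pv12-g7-0`, handover (none; imports are TREE modules only: HodgeCM.PerL34.FockUnitaryAction (pv05-g6, r28) + HodgeCM.PerL34.FockPrintPlaces (pv12-g7, r28)) ; any time after the installed r28 tree (no queue dependency; additive leaf, nothing imports it) (`HOME/pub-hodgecm-pv12-g7/lean/Pv12g7/FockPrintGenuineTorus.lean`, md5 45105621, 357 lines);
landed by the gen-8 packager in gate run 29 as `HodgeCM/PerL34/FockPrintGenuineTorus.lean` (verbatim).
-/
import Summits.HodgeConjecture.HodgeCM.PerL34.FockUnitaryAction_2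
import Summits.HodgeConjecture.HodgeCM.PerL34.FockPrintPlaces

/-!
# FockPrintGenuineTorus — the printed torus characters of the Fock dictionary ARE the characters of
Folland's genuine unitary action `ν₀` on the `L²` Fock space (PerL v5 ll. 485–486, 505–511 at Hilbert-space level)

Cell `pub-hodgecm`, seat `planner-pub-hodgecm-pv12-g7-0` (DAG-NODE PROVER #12 gen 7, Fock-model seat), file #8
(RUN 29/30 queue).  KERNEL ONLY — nothing is cited, no hypothesis is introduced, no statement of another seat is
touched.  Imports: the landed run-28 modules `HodgeCM.PerL34.FockUnitaryAction` (pv05-g6: Folland's unitary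
representation `ν₀ = Hermite.fockRep : U(σ) →* U(𝓕_σ)` of [Fo89 Prop (4.39)] on the genuine `L²` Fock space
`Hermite.FockL2 σ`, with `Hermite.fockRep_fockToL2 : ν₀(U)(F·e^{−(π/2)|z|²}) = (F ∘ U⁻¹)·e^{−(π/2)|z|²}`) and
`HodgeCM.PerL34.FockPrintPlaces` (this seat, #3: the printed local data `printLoc`, whose torus characters are
`printLoc_χ_sigma/delta : χ_b = vac_b` and `printLoc_χ_iota : χ_{ι₁} = vac_{ι₁} · (t₁t₂)`), hence `ArchB`
(`weightOp`, `wt`, `colWt`, `detZ`, `weightOp_colWt_detZ`, `weightOp_colWt_z`).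

## Source (PerL v5, `HOME/inputs/2001/…PerL-v5-FULL-d912a121.tex`, verbatim)

* ll. 485–486 (L4.1(b)): "$T_b=\U(W_{1,b})\times\U(W_{2,b})$ acts by the character $-w_b:=(-e_b(\Psi_1),-e_b(\Psi_2))$".
* l. 505: "$\mathcal F_b=\mathbb C[z_{aj},w_j]_{a,j\in\{1,2\}}$"; ll. 509–511: "$\mathcal F^{\kappa}_{\iota_1}=\mathbb C\det(z)$,
  $\varphi^0_{\iota_1}:=\det(z)=z_{11}z_{22}-z_{21}z_{12}$ … on which $T'_{\iota_1}$ acts by $\det$".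
* `ArchB.colWt` (tree, docstring): "Column-`j` weight = the polynomial part of the action of `U(W_{j,b}) = U(1)`
  (the `j`-th factor of `T_b`): `z_{aj} ↦ u z_{aj}`, `w_j ↦ u⁻¹ w_j`."

## What this file proves (the EXPONENTIATION DICTIONARY: infinitesimal weight ↦ genuine group character)

Up to now the tree had the torus action on Fock models twice, unconnected: INFINITESIMALLY on the polynomial
model (`ArchB.weightOp s = Σ_k s_k X_k ∂_k`, integer exponents `s : σ → ℤ`; the dictionary leaves
`FockPrint*` print characters such as `printLoc_χ_iota` FORMALLY from these weights), and GENUINELY on `L²(ℂ^σ)`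
(pv05-g6 `Hermite.fockRep`, so far only with the centre `S¹` made explicit, `fockRep_scalarU_fockVec`).  Here:

* §1 `phaseU d` (`d : σ → S¹`): the diagonal unitary `diag(d_k) ∈ U(σ)`, a monoid hom `phaseUHom`; `torusU s u :=
  phaseU (k ↦ u^{−s_k})`, the one-parameter torus with integer exponents `s`, a monoid hom `torusHom s : S¹ →* U(σ)`,
  chosen so that `ν₀(torusU s u)` substitutes `X_k ↦ u^{s_k} X_k` (`linSubst_star_torusU_X`).
* §2 `linSubst_diagonal_monomial`: a diagonal substitution multiplies the monomial `z^m` by `∏_k v_k^{m_k}`;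
  `fockRep_phaseU_fockToL2_of_forall`: a polynomial all of whose monomials acquire the same factor `c` gives an
  HONEST eigenvector `F·e^{−(π/2)|z|²} ∈ 𝓕_σ ⊂ L²(ℂ^σ)` of `ν₀(diag d)` with eigenvalue `c`.
* §3 **`fockRep_torusU_fockToL2_of_weightOp`** — THE DICTIONARY: if `weightOp s F = n • F` (`n : ℤ`, an
  infinitesimal weight vector of the polynomial model) then `ν₀(torusU s u)(F·e^{−(π/2)|z|²}) = u^n · (F·e^{−(π/2)|z|²})`
  for every `u ∈ S¹` — the genuine unitary torus acts on the honest `L²` vector by the character `u ↦ u^n`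
  (`ArchB.wt_eq_of_weightOp_eq_smul` monomial by monomial, `u^{Σ s_k m_k} = ∏ (u^{s_k})^{m_k}`).  The vacuum
  `1·e^{−(π/2)|z|²}` is fixed by all of `U(σ)` (`fockRep_fockToL2_one`).
* §4 the plane model at `ι₁` (`σ := ArchB.PlaneVar`, variables `z_{aj}, w_j`): the torus
  `T_{ι₁} = U(W_{1,ι₁}) × U(W_{2,ι₁}) = S¹ × S¹` acts through `planeTorusHom u := torusU (colWt 0) u₁ · torusU (colWt 1) u₂`
  (column `j` by `u_j` on `z_{aj}`, by `u_j⁻¹` on `w_j`, exactly `ArchB.colWt`); a joint weight vector of weights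
  `(n₀, n₁)` is a genuine eigenvector with character `u₁^{n₀} u₂^{n₁}` (`fockRep_planeTorus_of_weightOp`); in particular
  **`fockRep_planeTorus_detZ : ν₀(T_{ι₁})(det z · e^{−(π/2)|z|²}) = (u₁u₂) · (det z · e^{−(π/2)|z|²})`** — PerL l. 510–511
  "acts by det" for the honest `L²` vector (from the tree's `weightOp_colWt_detZ`), and `fockRep_planeTorus_z_zero/_one`
  (`z_{aj}` has character `u_j`).
* §5 junction with the printed places of #3: `printLoc_χ_iota_genuine` — the PRINTED `ι₁` character
  `(printLoc λ hλ vac ι).χ u = vac(u)·u₁u₂` is `vac(u)` (the external centre / `χ_V`-splitting twist, D5 datum, pinned by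
  pv11-g8 `pinnedVacs`) times the GENUINE eigenvalue of `ν₀(T_{ι₁})` on `det z`; `printLoc_χ_vacuum_genuine` — at
  `b ∈ Σ₁₂ ∪ D₁₂` the printed character `vac(u)` is `vac(u)` times the genuine eigenvalue `1` of any `U ∈ U(σ)` on the
  vacuum.  So every torus character the S4 record `PrintedAnalyticSide` prints is realised on an honest non-zero
  vector of Folland's Hilbert space (non-vanishing: `Hermite.fockToL2` is injective on polynomials, pv05 lane).

Honest scope: (i) the identification `T_b ↪ U(σ)` as a DIAGONAL torus with the exponents `colWt` is the tree's
dictionary (`ArchB.colWt` docstring = PerL l. 505 conventions); the opposite sign datum at `ι₁` (this seat's #6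
`conjWt`) is the complex-conjugate embedding `u ↦ planeTorusHom u⁻¹`, covered by the same theorems with `n ↦ −n`.
(ii) Nothing here asserts which `T_b`-characters occur in `θ`-lifts (that is L4.1(a)/(c), nodes N27/N29).
(iii) pv05-g6's RUN-29 rows `FockInvariantLines` §2 (`Hermite.diagHom`, `fockRep_diagHom_fockVec`) and
`FockPkIrreducible` (`torusChar`) give the same diagonal torus on the HERMITE BASIS `fockVec β`; this file is the
complementary statement for ARBITRARY weight vectors `fockToL2 F` of the INFINITESIMAL weight operators of `ArchB`,
which is the form the dictionary leaves (`det z`, twisted vectors, `IsKappaVector`) come in; when #4 lands,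
`phaseU d = Hermite.diagHom d` should be `Subtype.ext rfl` (both are `Matrix.diagonal`), to be recorded by pv12-g8.
-/

set_option autoImplicit false

namespace HodgeCM.PerL34.Fock.PrintDict

open MvPolynomial Complex

/-! ## §0  Two bookkeeping lemmas -/

/-- `a^{Σ f} = ∏ a^{f_i}` for integer exponents in a commutative group. -/
theorem zpow_finset_sum {ι G : Type*} [CommGroup G] [DecidableEq ι] (a : G) (s : Finset ι) (f : ι → ℤ) :
    a ^ (∑ i ∈ s, f i) = ∏ i ∈ s, a ^ f i := by
  refine Finset.induction_on s ?_ ?_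
  · rw [Finset.sum_empty, Finset.prod_empty, zpow_zero]
  · intro i s hi ih
    rw [Finset.sum_insert hi, Finset.prod_insert hi, zpow_add, ih]

/-- The coercion `S¹ → ℂ` of a finite product. -/
theorem circle_coe_prod {ι : Type*} (s : Finset ι) (g : ι → Circle) :
    (((∏ i ∈ s, g i : Circle)) : ℂ) = ∏ i ∈ s, (g i : ℂ) :=
  map_prod Circle.coeHom g s

section General

variable {σ : Type*} [Fintype σ] [DecidableEq σ]

/-! ## §1  Diagonal unitaries `diag(d_k)`, `d_k ∈ S¹`, and the integer-exponent tori `u ↦ diag(u^{−s_k})` -/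

/-- The diagonal unitary `diag(d_k) ∈ U(σ)` with unit-circle entries. -/
noncomputable def phaseU (d : σ → Circle) : Matrix.unitaryGroup σ ℂ :=
  ⟨Matrix.diagonal fun k => (d k : ℂ), by
    rw [Matrix.mem_unitaryGroup_iff, Matrix.star_eq_conjTranspose, Matrix.diagonal_conjTranspose,
      Matrix.diagonal_mul_diagonal, ← Matrix.diagonal_one]
    congr 1
    funext k
    rw [Pi.star_apply, Complex.star_def, Complex.mul_conj, Circle.normSq_coe, Complex.ofReal_one]⟩

/-- (Ported verbatim from the HodgeCMPerL package; no docstring in the source.) -/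
@[simp] theorem coe_phaseU (d : σ → Circle) :
    (phaseU d : Matrix σ σ ℂ) = Matrix.diagonal fun k => (d k : ℂ) := rfl

/-- (Ported verbatim from the HodgeCMPerL package; no docstring in the source.) -/
theorem phaseU_one : phaseU (1 : σ → Circle) = 1 :=
  Subtype.ext (by rw [coe_phaseU]; exact Matrix.diagonal_one)

/-- (Ported verbatim from the HodgeCMPerL package; no docstring in the source.) -/
theorem phaseU_mul (d e : σ → Circle) : phaseU (d * e) = phaseU d * phaseU e := by
  apply Subtype.ext
  change Matrix.diagonal (fun k => ((d * e) k : ℂ))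
    = Matrix.diagonal (fun k => (d k : ℂ)) * Matrix.diagonal (fun k => (e k : ℂ))
  exact (Matrix.diagonal_mul_diagonal _ _).symm

/-- `d ↦ diag(d)` as a monoid homomorphism `(σ → S¹) →* U(σ)`. -/
noncomputable def phaseUHom : (σ → Circle) →* Matrix.unitaryGroup σ ℂ where
  toFun := phaseU
  map_one' := phaseU_one
  map_mul' := phaseU_mul

/-- (Ported verbatim from the HodgeCMPerL package; no docstring in the source.) -/
@[simp] theorem phaseUHom_apply (d : σ → Circle) : phaseUHom d = phaseU d := rfl

/-- `diag(d)⁻¹ = diag(d)ᴴ = diag(d_k⁻¹)`. -/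
theorem star_coe_phaseU (d : σ → Circle) :
    star (phaseU d : Matrix σ σ ℂ) = Matrix.diagonal fun k => (((d k)⁻¹ : Circle) : ℂ) := by
  rw [coe_phaseU, Matrix.star_eq_conjTranspose, Matrix.diagonal_conjTranspose]
  congr 1
  funext k
  rw [Pi.star_apply, Complex.star_def, ← Circle.coe_inv_eq_conj]

/-- The one-parameter diagonal torus with integer exponents `s`: `u ↦ diag(u^{−s_k})` — the sign chosen so that
Folland's `ν₀(U) G = G ∘ U⁻¹` substitutes `X_k ↦ u^{s_k} X_k` (`linSubst_star_torusU_X`), i.e. `s` are the exponents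
of the action ON THE COORDINATE FUNCTIONS, as in `ArchB.weightOp s = Σ s_k X_k ∂_k`. -/
noncomputable def torusU (s : σ → ℤ) (u : Circle) : Matrix.unitaryGroup σ ℂ := phaseU fun k => (u ^ s k)⁻¹

/-- (Ported verbatim from the HodgeCMPerL package; no docstring in the source.) -/
theorem torusU_one (s : σ → ℤ) : torusU s 1 = 1 := by
  unfold torusU
  simp_rw [one_zpow, inv_one]
  exact phaseU_one

/-- (Ported verbatim from the HodgeCMPerL package; no docstring in the source.) -/
theorem torusU_mul (s : σ → ℤ) (u v : Circle) : torusU s (u * v) = torusU s u * torusU s v := by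
  unfold torusU
  rw [← phaseU_mul]
  congr 1
  funext k
  rw [Pi.mul_apply, mul_zpow, mul_inv]

/-- Two such tori commute (both are diagonal). -/
theorem torusU_comm (s t : σ → ℤ) (u v : Circle) : torusU s u * torusU t v = torusU t v * torusU s u := by
  unfold torusU
  rw [← phaseU_mul, ← phaseU_mul, mul_comm]

/-- `u ↦ diag(u^{−s_k})` as a monoid homomorphism `S¹ →* U(σ)`. -/
noncomputable def torusHom (s : σ → ℤ) : Circle →* Matrix.unitaryGroup σ ℂ where
  toFun := torusU s
  map_one' := torusU_one s
  map_mul' := torusU_mul s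

/-- (Ported verbatim from the HodgeCMPerL package; no docstring in the source.) -/
@[simp] theorem torusHom_apply (s : σ → ℤ) (u : Circle) : torusHom s u = torusU s u := rfl

/-- (Ported verbatim from the HodgeCMPerL package; no docstring in the source.) -/
theorem star_coe_torusU (s : σ → ℤ) (u : Circle) :
    star (torusU s u : Matrix σ σ ℂ) = Matrix.diagonal fun k => ((u ^ s k : Circle) : ℂ) := by
  rw [torusU, star_coe_phaseU]
  simp_rw [inv_inv]

/-! ## §2  Diagonal substitutions on polynomials and on the `L²` Fock vectors `F·e^{−(π/2)|z|²}` -/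

omit [Fintype σ] in
/-- A diagonal substitution scales each variable: `X_k ↦ v_k X_k`. -/
theorem linSubst_diagonal_X [Fintype σ] (v : σ → ℂ) (k : σ) :
    Hermite.linSubst (Matrix.diagonal v) (X k) = C (v k) * X k := by
  rw [Hermite.linSubst_X, Finset.sum_eq_single k]
  · rw [Matrix.diagonal_apply_eq]
  · intro j _ hjk
    rw [Matrix.diagonal_apply_ne _ (Ne.symm hjk), map_zero, zero_mul]
  · intro hk
    exact absurd (Finset.mem_univ k) hk

/-- `ν₀(torusU s u)` substitutes `X_k ↦ u^{s_k} X_k`. -/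
theorem linSubst_star_torusU_X (s : σ → ℤ) (u : Circle) (k : σ) :
    Hermite.linSubst (star (torusU s u : Matrix σ σ ℂ)) (X k) = C ((u ^ s k : Circle) : ℂ) * X k := by
  rw [star_coe_torusU, linSubst_diagonal_X]

/-- A diagonal substitution multiplies the monomial `c·z^m` by `∏_k v_k^{m_k}`. -/
theorem linSubst_diagonal_monomial (v : σ → ℂ) (m : σ →₀ ℕ) (c : ℂ) :
    Hermite.linSubst (Matrix.diagonal v) (monomial m c) = C (∏ k, v k ^ m k) * monomial m c := by
  have h1 : Hermite.linSubst (Matrix.diagonal v) = bind₁ (fun k => C (v k) * X k) := by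
    apply MvPolynomial.algHom_ext
    intro k
    rw [linSubst_diagonal_X, bind₁_X_right]
  have hv : ∏ k ∈ m.support, v k ^ m k = ∏ k, v k ^ m k :=
    Finset.prod_subset (Finset.subset_univ _) fun k _ hk => by
      rw [Finsupp.notMem_support_iff.mp hk, pow_zero]
  rw [h1, bind₁_monomial, Finset.prod_congr rfl (fun i _ => mul_pow (C (v i)) (X i) (m i)),
    Finset.prod_mul_distrib]
  simp_rw [← map_pow]
  rw [← map_prod, hv, monomial_eq, Finsupp.prod]
  ring

/-- If every monomial of `F` acquires the same factor `c` under the diagonal substitution, `F ↦ c·F`. -/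
theorem linSubst_diagonal_of_forall_prod_eq (v : σ → ℂ) (F : MvPolynomial σ ℂ) (c : ℂ)
    (h : ∀ m ∈ F.support, ∏ k, v k ^ m k = c) : Hermite.linSubst (Matrix.diagonal v) F = C c * F := by
  conv_lhs => rw [F.as_sum]
  rw [map_sum, Finset.sum_congr rfl (fun m hm => by rw [linSubst_diagonal_monomial, h m hm]),
    ← Finset.mul_sum, ← F.as_sum]

/-- **Honest eigenvectors of a diagonal unitary.**  If every monomial of `F` acquires the same factor `c` under
`X_k ↦ d_k⁻¹ X_k`, then the genuine `L²` vector `F·e^{−(π/2)|z|²} ∈ 𝓕_σ` is an eigenvector of `ν₀(diag d)` with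
eigenvalue `c` (Folland (4.39) via `Hermite.fockRep_fockToL2`). -/
theorem fockRep_phaseU_fockToL2_of_forall (d : σ → Circle) (F : MvPolynomial σ ℂ) (c : ℂ)
    (h : ∀ m ∈ F.support, ∏ k, (((d k)⁻¹ : Circle) : ℂ) ^ m k = c) :
    Hermite.fockRep (phaseU d) (Hermite.fockToL2 F) = c • Hermite.fockToL2 F := by
  rw [Hermite.fockRep_fockToL2, star_coe_phaseU, linSubst_diagonal_of_forall_prod_eq _ F c h,
    MvPolynomial.C_mul', map_smul]

/-- The vacuum `1·e^{−(π/2)|z|²}` is fixed by every `U ∈ U(σ)` (PerL l. 475 "vacuum line", l. 485 at `b ≠ ι₁`). -/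
theorem fockRep_fockToL2_one (U : Matrix.unitaryGroup σ ℂ) :
    Hermite.fockRep U (Hermite.fockToL2 (1 : MvPolynomial σ ℂ)) = Hermite.fockToL2 1 := by
  rw [Hermite.fockRep_fockToL2, map_one]

/-! ## §3  THE DICTIONARY: an infinitesimal weight vector of weight `n` has genuine character `u ↦ u^n` -/

/-- For a monomial `m`, `∏_k (u^{s_k})^{m_k} = u^{wt s m}` (`ArchB.wt s m = Σ_k s_k m_k`). -/
theorem prod_coe_zpow_pow_eq (s : σ → ℤ) (u : Circle) (m : σ →₀ ℕ) :
    ∏ k, ((u ^ s k : Circle) : ℂ) ^ m k = ((u ^ wt s m : Circle) : ℂ) := by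
  have h1 : ∏ k, ((u ^ s k : Circle) : ℂ) ^ m k = (((∏ k, (u ^ s k) ^ m k : Circle)) : ℂ) := by
    rw [circle_coe_prod]
    simp_rw [Circle.coe_pow]
  rw [h1, wt, zpow_finset_sum]
  congr 1
  refine Finset.prod_congr rfl fun k _ => ?_
  rw [← zpow_natCast, ← zpow_mul]

/-- **The exponentiation dictionary.**  If `F` is a weight vector of the infinitesimal weight operator
`weightOp s = Σ_k s_k X_k ∂_k` with integer weight `n` (the polynomial Fock model of `ArchB` / the `FockPrint*`
leaves), then the honest `L²` vector `F·e^{−(π/2)|z|²}` is an eigenvector of the genuine unitary torus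
`u ↦ ν₀(torusU s u)` of Folland's representation with the CHARACTER `u ↦ u^n`. -/
theorem fockRep_torusU_fockToL2_of_weightOp (s : σ → ℤ) {F : MvPolynomial σ ℂ} {n : ℤ}
    (h : weightOp s F = (n : ℂ) • F) (u : Circle) :
    Hermite.fockRep (torusU s u) (Hermite.fockToL2 F) = ((u ^ n : Circle) : ℂ) • Hermite.fockToL2 F := by
  apply fockRep_phaseU_fockToL2_of_forall
  intro m hm
  simp_rw [inv_inv]
  rw [prod_coe_zpow_pow_eq, wt_eq_of_weightOp_eq_smul h hm]

/-- The same through the bundled hom `torusHom s : S¹ →* U(σ)`. -/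
theorem fockRep_torusHom_fockToL2_of_weightOp (s : σ → ℤ) {F : MvPolynomial σ ℂ} {n : ℤ}
    (h : weightOp s F = (n : ℂ) • F) (u : Circle) :
    Hermite.fockRep (torusHom s u) (Hermite.fockToL2 F) = ((u ^ n : Circle) : ℂ) • Hermite.fockToL2 F :=
  fockRep_torusU_fockToL2_of_weightOp s h u

/-- Weight `0` (e.g. a vector killed by `weightOp s`): genuinely INVARIANT under the torus. -/
theorem fockRep_torusU_fockToL2_of_weightOp_zero (s : σ → ℤ) {F : MvPolynomial σ ℂ}
    (h : weightOp s F = 0) (u : Circle) :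
    Hermite.fockRep (torusU s u) (Hermite.fockToL2 F) = Hermite.fockToL2 F := by
  have h' : weightOp s F = ((0 : ℤ) : ℂ) • F := by rw [h, Int.cast_zero, zero_smul]
  rw [fockRep_torusU_fockToL2_of_weightOp s h' u, zpow_zero, Circle.coe_one, one_smul]

/-- `ν₀` of a product, applied. -/
theorem fockRep_mul_apply (U V : Matrix.unitaryGroup σ ℂ) (g : Hermite.FockL2 σ) :
    Hermite.fockRep (U * V) g = Hermite.fockRep U (Hermite.fockRep V g) := by
  rw [Hermite.fockRep_apply, Hermite.fockOp_mul, ← Hermite.fockRep_apply, ← Hermite.fockRep_apply]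

end General

/-! ## §4  The plane model at `ι₁`: `T_{ι₁} = U(W_{1,ι₁}) × U(W_{2,ι₁})` acting on `𝓕_{PlaneVar} ⊂ L²(ℂ⁶)` -/

section Plane

/-- The real torus `T_{ι₁} = S¹ × S¹` in `U(PlaneVar)`: the factor `U(W_{j,ι₁})` acts on the coordinate functions
by `z_{aj} ↦ u_j z_{aj}`, `w_j ↦ u_j⁻¹ w_j` (exponents `ArchB.colWt j`; PerL l. 505). -/
noncomputable def planeTorusHom : Circle × Circle →* Matrix.unitaryGroup PlaneVar ℂ where
  toFun u := torusU (colWt 0) u.1 * torusU (colWt 1) u.2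
  map_one' := by
    rw [Prod.fst_one, Prod.snd_one, torusU_one, torusU_one, one_mul]
  map_mul' u v := by
    rw [Prod.fst_mul, Prod.snd_mul, torusU_mul, torusU_mul, mul_assoc, mul_assoc,
      ← mul_assoc (torusU (colWt 0) v.1), torusU_comm (colWt 0) (colWt 1) v.1 u.2, mul_assoc]

/-- (Ported verbatim from the HodgeCMPerL package; no docstring in the source.) -/
theorem planeTorusHom_apply (u : Circle × Circle) :
    planeTorusHom u = torusU (colWt 0) u.1 * torusU (colWt 1) u.2 := rfl

/-- **Joint weight vectors are genuine `T_{ι₁}`-eigenvectors.**  If `weightOp (colWt 0) F = n₀ • F` and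
`weightOp (colWt 1) F = n₁ • F`, then `ν₀(T_{ι₁})` acts on `F·e^{−(π/2)|z|²}` by the character `(u₁,u₂) ↦ u₁^{n₀} u₂^{n₁}`. -/
theorem fockRep_planeTorus_of_weightOp {F : PlaneModel} {n₀ n₁ : ℤ}
    (h₀ : weightOp (colWt 0) F = (n₀ : ℂ) • F) (h₁ : weightOp (colWt 1) F = (n₁ : ℂ) • F) (u : Circle × Circle) :
    Hermite.fockRep (planeTorusHom u) (Hermite.fockToL2 F)
      = ((u.1 ^ n₀ * u.2 ^ n₁ : Circle) : ℂ) • Hermite.fockToL2 F := by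
  rw [planeTorusHom_apply, fockRep_mul_apply, fockRep_torusU_fockToL2_of_weightOp (colWt 1) h₁ u.2,
    LinearIsometryEquiv.map_smul, fockRep_torusU_fockToL2_of_weightOp (colWt 0) h₀ u.1, smul_smul,
    ← Circle.coe_mul, mul_comm (u.2 ^ n₁)]

/-- **PerL ll. 509–511, GENUINELY: `T_{ι₁}` acts on `φ⁰_{ι₁} = det(z)` by `det`.**  The honest `L²` vector
`det(z)·e^{−(π/2)|z|²} ∈ 𝓕 ⊂ L²(ℂ⁶)` is an eigenvector of `ν₀(T_{ι₁})` with character `(u₁,u₂) ↦ u₁u₂`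
(from the tree's infinitesimal statement `ArchB.weightOp_colWt_detZ : weightOp (colWt j) det z = det z`). -/
theorem fockRep_planeTorus_detZ (u : Circle × Circle) :
    Hermite.fockRep (planeTorusHom u) (Hermite.fockToL2 detZ)
      = ((u.1 * u.2 : Circle) : ℂ) • Hermite.fockToL2 detZ := by
  have h₀ : weightOp (colWt 0) detZ = ((1 : ℤ) : ℂ) • detZ := by rw [weightOp_colWt_detZ, Int.cast_one, one_smul]
  have h₁ : weightOp (colWt 1) detZ = ((1 : ℤ) : ℂ) • detZ := by rw [weightOp_colWt_detZ, Int.cast_one, one_smul]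
  rw [fockRep_planeTorus_of_weightOp h₀ h₁ u, zpow_one, zpow_one]

/-- The coordinate function `z_{a0}` has genuine `T_{ι₁}`-character `u₁` (`ArchB.weightOp_colWt_z`). -/
theorem fockRep_planeTorus_z_zero (u : Circle × Circle) (a : Fin 2) :
    Hermite.fockRep (planeTorusHom u) (Hermite.fockToL2 (z a 0)) = (u.1 : ℂ) • Hermite.fockToL2 (z a 0) := by
  have h₀ : weightOp (colWt 0) (z a 0) = ((1 : ℤ) : ℂ) • z a 0 := by
    rw [weightOp_colWt_z, if_pos rfl, Int.cast_one]
  have h₁ : weightOp (colWt 1) (z a 0) = ((0 : ℤ) : ℂ) • z a 0 := by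
    rw [weightOp_colWt_z, if_neg Fin.zero_ne_one, Int.cast_zero]
  rw [fockRep_planeTorus_of_weightOp h₀ h₁ u, zpow_one, zpow_zero, mul_one]

/-- The coordinate function `z_{a1}` has genuine `T_{ι₁}`-character `u₂`. -/
theorem fockRep_planeTorus_z_one (u : Circle × Circle) (a : Fin 2) :
    Hermite.fockRep (planeTorusHom u) (Hermite.fockToL2 (z a 1)) = (u.2 : ℂ) • Hermite.fockToL2 (z a 1) := by
  have h₀ : weightOp (colWt 0) (z a 1) = ((0 : ℤ) : ℂ) • z a 1 := by
    rw [weightOp_colWt_z, if_neg Fin.zero_ne_one.symm, Int.cast_zero]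
  have h₁ : weightOp (colWt 1) (z a 1) = ((1 : ℤ) : ℂ) • z a 1 := by
    rw [weightOp_colWt_z, if_pos rfl, Int.cast_one]
  rw [fockRep_planeTorus_of_weightOp h₀ h₁ u, zpow_one, zpow_zero, one_mul]

/-- The vacuum of the plane model is `T_{ι₁}`-fixed. -/
theorem fockRep_planeTorus_one (u : Circle × Circle) :
    Hermite.fockRep (planeTorusHom u) (Hermite.fockToL2 (1 : PlaneModel)) = Hermite.fockToL2 1 :=
  fockRep_fockToL2_one _

end Plane

/-! ## §5  Junction with the printed places (`FockPrintPlaces`, #3): printed character = `vac` × genuine eigenvalue -/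

section Printed

variable (lam : ℂ) (hlam : lam ≠ 0) (vac : Circle × Circle →* Circle)

/-- **At `b = ι₁`**: the PRINTED character `(printLoc λ hλ vac ι).χ u = vac(u)·u₁u₂` of #3 is the external centre
twist `vac(u)` times the GENUINE eigenvalue of `ν₀(T_{ι₁})` on the honest vector `det(z)·e^{−(π/2)|z|²}`:
`χ_{ι₁}(u) · (det z · e^{−…}) = vac(u) · ν₀(T_{ι₁})(u) (det z · e^{−…})` in `L²(ℂ⁶)`. -/
theorem printLoc_χ_iota_genuine (u : Circle × Circle) :
    (printLoc lam hlam vac .iota).χ u • Hermite.fockToL2 detZ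
      = (vac u : ℂ) • Hermite.fockRep (planeTorusHom u) (Hermite.fockToL2 detZ) := by
  rw [printLoc_χ_iota, fockRep_planeTorus_detZ, smul_smul, Circle.coe_mul]

/-- **At `b ∈ Σ₁₂ ∪ D₁₂`**: the printed character `vac(u)` is `vac(u)` times the genuine eigenvalue `1` of ANY
`U ∈ U(σ)` on the vacuum `1·e^{−(π/2)|z|²}` of the relevant Fock space (PerL ll. 485–486 / 497–503: at these places
`φ⁰_b` is the constant, and the torus character is the centre twist alone). -/
theorem printLoc_χ_vacuum_genuine {τ : Type*} [Fintype τ] [DecidableEq τ] (U : Matrix.unitaryGroup τ ℂ)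
    (u : Circle × Circle) :
    ((printLoc lam hlam vac .sigma).χ u • Hermite.fockToL2 (1 : MvPolynomial τ ℂ)
        = (vac u : ℂ) • Hermite.fockRep U (Hermite.fockToL2 1)) ∧
    ((printLoc lam hlam vac .delta).χ u • Hermite.fockToL2 (1 : MvPolynomial τ ℂ)
        = (vac u : ℂ) • Hermite.fockRep U (Hermite.fockToL2 1)) := by
  rw [printLoc_χ_sigma, printLoc_χ_delta, fockRep_fockToL2_one]
  exact ⟨rfl, rfl⟩

end Printed

end HodgeCM.PerL34.Fock.PrintDict
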